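import Summits.ABC.IUTFork.Repair.RHLWindowTable
import Summits.ABC.IUTFork.Repair.RHHeightClassKLineLaw
import HarnessLib

/-!
# D-0079 RESCUE sub-cell R-H, D-0121 (2) «L-WINDOW» — the K-LINE FOR EVERY `k`: on `λ_k = 1/2 + 2/7^k` the window
# «`λ_k ∈ Σ₈` at the admissible prime `l`» ∧ «content of [IUTchIV] Thm. 1.10's display at `(λ_k, l)`» is EMPTY FOR ALL `k`, BY THEOREM

PROOF-ONLY sequel (0 definitions) of `RHLWindowTable` (p488757, §3: content fails at `(ratPoint λ_k, l)` for `k ≤ 5.5·10⁶`) and of abc-iut-rh-typ-8's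
K-line law `RHHeightClassKLineLaw` (p476616 lineage: `strictMinPow_ge_neg_of_lt`, `kline_out_of_lt`; `exists_strictMinPow_kline`). Seat abc-iut-lwin-typ-1
gen 0; abc-iut-rh-lead g3 D0121-SPEC §2 («the K-line family shows how it scales»); referee rh2-exp-ref; rung LADDER-ABC:A2.RESCUE.H.

THE TWO SIDES PULL APART, for every `k`. In the K-line integer currency of `RHHeightClassKLine*` (`p = 7 < l` prime, local type `e_w = l·ε`,
`m_q = k·ε`, `1 ≤ ε ≤ 30` = the range of the type law `ε(k) = 2^[k odd]·15/gcd(15,k)`, top label `l⋆ = l/2`):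
* CONTENT SIDE (`RHLWindowTable` §1 + abc-iut-w5-d044's `Cor22.logQForall_ratPoint_lamSeven_le`): the content guard at `(ratPoint λ_k, l)` forces
  `120·552960·l < log q^{∤{2,l}}(λ_k) ≤ 6k·log 7 + 12·log 2 ≤ 12k + 12`, i.e. **`k ≥ 5 529 600·l`** (`le_of_content_ratPoint_lamSeven`);
* SLICE SIDE (row 8, Σ₈): at the untied `r♯ = r♯(7, l·ε)` one has `r♯ ≥ −30l·(l·ε)` (`strictMinPow_ge_neg_of_lt` with `T = 30l`, `l·ε ≤ 30l < 6·7^{30l}`),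
  so the top cell «`(l⋆²−1)·kε ≤ l⋆(lε − r♯) + (1 − r♯)`» has right side `≤ ε·(l⋆l + 30(l⋆+1)l²) + 1 = O(l³ε)` while its left side is `≥ (l⋆²−1)·kε`;
  with `k ≥ 5 529 600·l` the cell FAILS (`kline_out_of_content`): **«content at `(λ_k, l)` ⟹ `λ_k ∉ Σ₈` at `l`»** for EVERY `k ≥ 1`, every prime `l ≥ 11`,
  every `1 ≤ ε ≤ 30` — the L-window of D-0121 (2) is EMPTY on the WHOLE K-line, not only on the tabulated `k ≤ 100` (B23's scaling block, gap factor
  `g(k) = 120·d*·l₀⁸(k)/log q_k → ∞`).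
`kline_lwindow_empty` states it in the window's own shape: NOT («in Σ₈ at `l`» ∧ «content at `l`»), with «in Σ₈ at `l`» := the top cell at the (existing,
`exists_strictMinPow_kline`) untied exponent, exactly as in `kline_in_of_pow_le`.
HONEST SCOPE. `HBand`/`StrictMinPow`/«Σ₈» are row 8's claim-tagged HYPOTHESIS vocabulary (abc-iut-rh-typ-8), never asserted; «in/out of Σ₈» = the
hypothesis's own top cell at the K-line integer data holds/fails; that a genuine Θ-datum over `(λ_k, l)` has local type `e_w = l·ε(k)` with `ε(k) ∣ 30`
at the places over `7` is abc-iut-W-num-3's law (kernel for even `k`: `GenuineK.localType_lamSeven_fifteen`), an INPUT here (`ε` is a parameter with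
`1 ≤ ε ≤ 30`). Nothing here asserts that abc is proved or refuted, or that [IUTchIII] Cor. 3.12 / [IUTchIV] Thm. 1.10 holds or fails anywhere; no side
is taken on any author; typed ≠ proved. [cite: Mochizuki2012, IUTchIV Thm. 1.10 pp. 22–23, Cor. 2.2 (ii) p. 46 l. 1; IUTchI Def. 3.1 (b)(c)(e) pp. 61–62]
[cite: MochizukiGenEll2010, Ex 1.3 (i) p.5] [claim: Mochizuki2012, status: disputed] for every IUT locution; the arithmetic is [folklore].
-/

noncomputable section

open Set Function NumberField IsDedekindDomain

namespace Summit.ABC.IUTFork.Repair.RH.LWindowTable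

open Literature.IUT.LogVolume Literature.IUT.LogVolume.Cor22
open Literature.NumberTheory.DiophantineGeometry.GenEll Summit.ABC.IUTFork.Conditional
open Summit.ABC.IUTFork.Repair.RHHeightClass Summit.ABC.IUTFork.Repair.RHHeightClass.KLine
open Summit.ABC.IUTFork.Repair.RH.Q3LTailBand

/-! ## §1 Content side: content at `(λ_k, l)` forces `k ≥ 5 529 600·l` -/

/-- **Content at `(ratPoint λ_k, l)` forces `k ≥ 5 529 600·l`** (`k ≥ 1`): the guard gives `120·2¹²·3³·5·d_mod·l < log q^{∤{2,l}}(λ_k)` (conductor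
term `≥ 0`), `d_mod ≥ 1`, and `log q^{∤{2,l}} ≤ log q^∀ ≤ 6k·log 7 + 12·log 2 ≤ 12k + 12` (`Cor22.logQForall_ratPoint_lamSeven_le`,
`six_mul_log_seven_add_le`); so `66 355 200·l < 12k + 12`. [cite: MochizukiGenEll2010, Ex 1.3 (i) p.5] [cite: Mochizuki2012, IUTchIV Thm. 1.10 pp. 22–23] -/
theorem le_of_content_ratPoint_lamSeven {k l : ℕ} (hk : 1 ≤ k)
    (h : 6 * ((1 + 20 * (dmod (ratPoint ((2 : ℚ)⁻¹ + 2 / 7 ^ k)) : ℝ) / l)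
            * ((ratPoint ((2 : ℚ)⁻¹ + 2 / 7 ^ k)).logDiff + logCondAvoid (ratPoint ((2 : ℚ)⁻¹ + 2 / 7 ^ k)) {2, l}))
          + 120 * (2 ^ 12 * 3 ^ 3 * 5 * (dmod (ratPoint ((2 : ℚ)⁻¹ + 2 / 7 ^ k)) : ℝ) * l)
        < logQAvoid (ratPoint ((2 : ℚ)⁻¹ + 2 / 7 ^ k)) {2, l}) :
    5529600 * l ≤ k := by
  set P : NFPoint := ratPoint ((2 : ℚ)⁻¹ + 2 / 7 ^ k) with hP
  have hD1 : (1 : ℝ) ≤ (dmod P : ℝ) := by exact_mod_cast dmod_pos P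
  have hLD : 0 ≤ P.logDiff := P.logDiff_nonneg
  have hLC : 0 ≤ logCondAvoid P {2, l} := logCondAvoid_nonneg P {2, l}
  have hl0 : (0 : ℝ) ≤ l := Nat.cast_nonneg _
  have h20 : (0 : ℝ) ≤ 20 * (dmod P : ℝ) / l := by positivity
  have h1 : 0 ≤ 6 * ((1 + 20 * (dmod P : ℝ) / l) * (P.logDiff + logCondAvoid P {2, l})) := by positivity
  have h2 : 120 * (2 ^ 12 * 3 ^ 3 * 5) * (l : ℝ) ≤ 120 * (2 ^ 12 * 3 ^ 3 * 5 * (dmod P : ℝ) * l) := by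
    nlinarith [mul_le_mul_of_nonneg_right hD1 hl0]
  have hq : logQAvoid P {2, l} ≤ 6 * (k : ℝ) * Real.log 7 + 12 * Real.log 2 :=
    ((logQAvoid_le_logQNotTwo_le P l).1.trans (logQAvoid_le_logQNotTwo_le P l).2).trans (logQForall_ratPoint_lamSeven_le hk)
  have hlog := six_mul_log_seven_add_le k
  have hreal : (5529600 : ℝ) * l < k + 1 := by linarith
  have hnat : 5529600 * l < k + 1 := by exact_mod_cast hreal
  omega

/-! ## §2 Slice side: for `k ≥ 5 529 600·l` the row-8 top cell fails at the untied exponent -/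

/-- `30·l < 6·7^{30l}` (so `T = 30l` bounds the minimiser of `t ↦ 7^t − t·(lε)` whenever `ε ≤ 30`). [folklore] -/
theorem thirty_mul_lt_six_mul_pow (l : ℕ) : ((30 * l : ℕ) : ℤ) < (7 : ℤ) ^ (30 * l) * ((7 : ℤ) - 1) := by
  have h : 30 * l < 7 ^ (30 * l) := Nat.lt_pow_self (by norm_num)
  have h' : ((30 * l : ℕ) : ℤ) < ((7 ^ (30 * l) : ℕ) : ℤ) := by exact_mod_cast h
  have h7 : (0 : ℤ) ≤ (7 : ℤ) ^ (30 * l) := by positivity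
  push_cast at h' ⊢
  linarith

/-- **SLICE SIDE: `k ≥ 5 529 600·l` ⟹ `λ_k ∉ Σ₈` at the prime `l ≥ 11`** (any `1 ≤ ε ≤ 30`): at every untied exponent `r` of `(7, l·ε)`
(`r ≥ −30l·(lε)` by `strictMinPow_ge_neg_of_lt`, `T = 30l`) the row-8 top cell «`(l⋆²−1)·kε ≤ l⋆(lε − r) + (1 − r)`» FAILS — its right side is
`≤ ε·(l⋆·l + 30(l⋆+1)·l²) + 1 ≤ 544·l⋆³·ε` (`l = 2l⋆+1 ≤ 3l⋆`), its left side `≥ (l⋆²−1)·5 529 600·l·ε ≥ 10⁷·l⋆³·ε`. Same shape as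
`RHHeightClass.KLine.kline_out_of_lt`'s conclusion. [folklore] -/
theorem kline_out_of_le {k l ε : ℕ} (hl : l.Prime) (h11 : 11 ≤ l) (hε : 1 ≤ ε) (hε30 : ε ≤ 30) (hk : 5529600 * l ≤ k) :
    ∀ r : ℤ, StrictMinPow 7 (l * ε) r →
      ¬ ((((l / 2 : ℕ) : ℤ)) ^ 2 - 1) * ((k : ℤ) * ε) ≤ ((l / 2 : ℕ) : ℤ) * (((l * ε : ℕ) : ℤ) - r) + (1 - r) := by
  intro r hr hcell
  have hodd : l % 2 = 1 := Nat.odd_iff.1 (hl.odd_of_ne_two (by omega))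
  -- the untied exponent is not too negative: `r ≥ −30l·(lε)` (`lε ≤ 30l < 6·7^{30l}`)
  have hT : ((l * ε : ℕ) : ℤ) < (7 : ℤ) ^ (30 * l) * ((7 : ℤ) - 1) := by
    have h1 : ((l * ε : ℕ) : ℤ) ≤ ((30 * l : ℕ) : ℤ) := by
      have : l * ε ≤ 30 * l := by nlinarith
      exact_mod_cast this
    exact lt_of_le_of_lt h1 (thirty_mul_lt_six_mul_pow l)
  have hrT : -(((30 * l : ℕ) : ℤ) * ((l * ε : ℕ) : ℤ)) ≤ r :=
    strictMinPow_ge_neg_of_lt (p := 7) (by norm_num) hr (by exact_mod_cast hT)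
  -- integer bookkeeping: `l = 2L + 1`, `L ≥ 5`, `ε ≥ 1`, `k ≥ 5529600·l`
  set L : ℤ := ((l / 2 : ℕ) : ℤ) with hLdef
  have hlL : (l : ℤ) = 2 * L + 1 := by omega
  have hL5 : (5 : ℤ) ≤ L := by omega
  have hε1 : (1 : ℤ) ≤ (ε : ℤ) := by exact_mod_cast hε
  have hkz : (5529600 : ℤ) * l ≤ (k : ℤ) := by exact_mod_cast hk
  have hle : ((l * ε : ℕ) : ℤ) = (l : ℤ) * (ε : ℤ) := by push_cast; ring
  have h30 : ((30 * l : ℕ) : ℤ) = 30 * (l : ℤ) := by push_cast; ring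
  rw [hle] at hcell hrT
  rw [h30] at hrT
  rw [hlL] at hcell hrT hkz
  -- (1) move `r` out of the cell with its lower bound (coefficient `L + 1 ≥ 0`)
  have hL1 : (0 : ℤ) ≤ L + 1 := by linarith
  have hmul : (L + 1) * (-(30 * (2 * L + 1) * ((2 * L + 1) * (ε : ℤ)))) ≤ (L + 1) * r :=
    mul_le_mul_of_nonneg_left hrT hL1
  have hcell' : (L ^ 2 - 1) * ((k : ℤ) * ε) ≤
      L * ((2 * L + 1) * (ε : ℤ)) + 1 + (L + 1) * (30 * (2 * L + 1) * ((2 * L + 1) * (ε : ℤ))) := by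
    nlinarith
  -- (2) the left side dominates: `(L²−1)·kε ≥ (L²−1)·5529600·(2L+1)·ε`
  have hL21 : (0 : ℤ) ≤ L ^ 2 - 1 := by nlinarith
  have hε0 : (0 : ℤ) ≤ (ε : ℤ) := by linarith
  have hlow : (L ^ 2 - 1) * ((5529600 : ℤ) * (2 * L + 1) * ε) ≤ (L ^ 2 - 1) * ((k : ℤ) * ε) :=
    mul_le_mul_of_nonneg_left (mul_le_mul_of_nonneg_right hkz hε0) hL21
  -- (3) the polynomial gap: `A(L) := (L²−1)·5529600·(2L+1) − (L(2L+1) + 30(L+1)(2L+1)²) ≥ 2` for `L ≥ 5`, and `ε·A ≥ A`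
  have hA : (2 : ℤ) ≤ (L ^ 2 - 1) * (5529600 * (2 * L + 1)) - (L * (2 * L + 1) + (L + 1) * (30 * (2 * L + 1) * (2 * L + 1))) := by
    nlinarith [mul_nonneg (mul_nonneg (sub_nonneg.2 hL5) (sub_nonneg.2 hL5)) (by linarith : (0 : ℤ) ≤ L)]
  have hAε : (L ^ 2 - 1) * (5529600 * (2 * L + 1)) - (L * (2 * L + 1) + (L + 1) * (30 * (2 * L + 1) * (2 * L + 1)))
      ≤ ((L ^ 2 - 1) * (5529600 * (2 * L + 1)) - (L * (2 * L + 1) + (L + 1) * (30 * (2 * L + 1) * (2 * L + 1)))) * (ε : ℤ) :=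
    le_mul_of_one_le_right (by linarith) hε1
  nlinarith

/-! ## §3 The window is empty on the whole K-line -/

/-- **CONTENT ⟹ OUT OF Σ₈ (every `k`).** For `k ≥ 1`, a prime `l ≥ 11` and `1 ≤ ε ≤ 30`: if the content guard of [IUTchIV] Thm. 1.10's display holds
at `(ratPoint λ_k, l)`, then at every untied exponent of `(7, l·ε)` the row-8 top cell with `m_q = k·ε` FAILS — `λ_k ∉ Σ₈` at `l`.
(`le_of_content_ratPoint_lamSeven` ∘ `kline_out_of_le`.) [claim: Mochizuki2012, status: disputed] for the reading; [folklore] arithmetic. -/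
theorem kline_out_of_content {k l ε : ℕ} (hk : 1 ≤ k) (hl : l.Prime) (h11 : 11 ≤ l) (hε : 1 ≤ ε) (hε30 : ε ≤ 30)
    (h : 6 * ((1 + 20 * (dmod (ratPoint ((2 : ℚ)⁻¹ + 2 / 7 ^ k)) : ℝ) / l)
            * ((ratPoint ((2 : ℚ)⁻¹ + 2 / 7 ^ k)).logDiff + logCondAvoid (ratPoint ((2 : ℚ)⁻¹ + 2 / 7 ^ k)) {2, l}))
          + 120 * (2 ^ 12 * 3 ^ 3 * 5 * (dmod (ratPoint ((2 : ℚ)⁻¹ + 2 / 7 ^ k)) : ℝ) * l)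
        < logQAvoid (ratPoint ((2 : ℚ)⁻¹ + 2 / 7 ^ k)) {2, l}) :
    ∀ r : ℤ, StrictMinPow 7 (l * ε) r →
      ¬ ((((l / 2 : ℕ) : ℤ)) ^ 2 - 1) * ((k : ℤ) * ε) ≤ ((l / 2 : ℕ) : ℤ) * (((l * ε : ℕ) : ℤ) - r) + (1 - r) :=
  kline_out_of_le hl h11 hε hε30 (le_of_content_ratPoint_lamSeven hk h)

/-- **`kline_lwindow_empty` — D-0121 (2) ON THE WHOLE K-LINE, BY THEOREM.** For EVERY `k ≥ 1`, every prime `l ≥ 11` and every `1 ≤ ε ≤ 30` it is NOT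
the case that both (A) «`λ_k ∈ Σ₈` at `l`» (the untied exponent of `(7, l·ε)` exists — it always does, `exists_strictMinPow_kline` — and the row-8 top cell
holds at it; the shape of `kline_in_of_pow_le`) and (B) «the display of [IUTchIV] Thm. 1.10 has content at `(ratPoint λ_k, l)`» hold: the admissible-`l`
window of the human's question is EMPTY along the entire family `λ_k = 1/2 + 2/7^k`, the tabulated `k ≤ 100` (B23, `RHLWindowTable`) being the first
hundred instances. [claim: Mochizuki2012, status: disputed] for the reading; [folklore] arithmetic. -/
theorem kline_lwindow_empty {k l ε : ℕ} (hk : 1 ≤ k) (hl : l.Prime) (h11 : 11 ≤ l) (hε : 1 ≤ ε) (hε30 : ε ≤ 30) :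
    ¬ (((∃ r : ℤ, StrictMinPow 7 (l * ε) r) ∧
          ∀ r : ℤ, StrictMinPow 7 (l * ε) r →
            ((((l / 2 : ℕ) : ℤ)) ^ 2 - 1) * ((k : ℤ) * ε) ≤ ((l / 2 : ℕ) : ℤ) * (((l * ε : ℕ) : ℤ) - r) + (1 - r)) ∧
        (6 * ((1 + 20 * (dmod (ratPoint ((2 : ℚ)⁻¹ + 2 / 7 ^ k)) : ℝ) / l)
            * ((ratPoint ((2 : ℚ)⁻¹ + 2 / 7 ^ k)).logDiff + logCondAvoid (ratPoint ((2 : ℚ)⁻¹ + 2 / 7 ^ k)) {2, l}))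
          + 120 * (2 ^ 12 * 3 ^ 3 * 5 * (dmod (ratPoint ((2 : ℚ)⁻¹ + 2 / 7 ^ k)) : ℝ) * l)
        < logQAvoid (ratPoint ((2 : ℚ)⁻¹ + 2 / 7 ^ k)) {2, l})) := by
  rintro ⟨⟨⟨r, hr⟩, hin⟩, hcontent⟩
  exact kline_out_of_content hk hl h11 hε hε30 hcontent r hr (hin r hr)

/-- The existence conjunct of (A) is never the obstruction: on the K-line the untied exponent exists at every prime `l ≥ 11` (`7 < l`,
abc-iut-rh-typ-8's `exists_strictMinPow_kline`), so `kline_lwindow_empty` says exactly «top cell at `r♯` ∧ content» is impossible. [folklore] -/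
theorem kline_exists_untied {l : ℕ} (hl : l.Prime) (h11 : 11 ≤ l) (ε : ℕ) : ∃ r : ℤ, StrictMinPow 7 (l * ε) r :=
  exists_strictMinPow_kline (p := 7) (by norm_num) hl (by omega) ε

end Summit.ABC.IUTFork.Repair.RH.LWindowTable

end
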